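import Mathlib
import HarnessLib

/-!
# Route LiouvilleSarnak — crux `LiouvilleCutRank` (stmt-ValiantsHypothesis-14775):
# the PERIODIC SATURATION ENGINE (self-similar cut families have eventually invariant rows)

`Theorems/LiouvilleSarnakLiouvilleCutRankInterleavedUnbounded.lean` settled the prototype `(CR)^n` by a
finiteness ("saturation") argument.  This file isolates its reusable combinatorial engine, valid for every
PERIODIC cut pattern `u^n` (and any self-similar sign matrix):

* ★ `exists_iterate_rows_eq` — let `A : X → Y → ℤ` have FINITELY many distinct rows and be self-similar,
  `A (ιX x) (ιY y) = s · A x y` with `s² = 1` (for the cut matrix `λ(1 + ρ + κ)` of a periodic word `u^∞` of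
  period `p`: `ιX ρ = R_{<p} + 2^p ρ`, `ιY κ = C_{<p} + 2^p κ`, `s = λ(2^p) = (-1)^p`).  Then there is `L ≥ 1` with
  `A (ιX^[L] x) = A x` for EVERY `x`: all rows are invariant under the `L`-th iterate of the substitution.
  (The map `res f = s · (f ∘ ιY)` sends the row of `ιX x` to the row of `x`, so it maps the finite row set onto
  itself, hence permutes it; `L` = a common period, e.g. `(#rows)!`.)
* `rows_eq_of_restrict_eq` — under the same hypotheses two rows that agree on the columns `ιY y` agree
  everywhere (`res` is injective on the row set).

Use (census evidence `evidence-14775-leafhand2-g5.md` on the item): for `u^∞` with `P = pL` this gives the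
INVARIANCE `λ(1 + ρ + κ) = λ(1 + R_{<P} + 2^P ρ + κ)` for all `ρ ∈ E_R, κ ∈ E_C`, from which one vertical identity
with an odd prime finishes a family: `(CR)^n` via `κ = R_{<P}/2 - 1`, `1 + R_{<P} + κ = 3(1+κ)` (landed);
`(C^k R^k)^n` for `λ(2^k+1) = -1` via `κ = R_{<P}/2^k - 1`; and the P-independent ROTATION CRITERION
`λ(val_C(u')) = λ(2^p - 1)` (`κ = C_{<P} - 1`).  Honest framing: a combinatorial engine, no new case of the crux
by itself; `LiouvilleCutRank`, `DigitalBilinearLiouville`, `AlgebraicSarnak` stay OPEN; nothing bears on `VP ≠ VNP`.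
No definitions; imports `Mathlib` only.
-/

set_option linter.dupNamespace false

namespace Summit.ValiantsHypothesis.ValiantsHypothesis.Theorems.LiouvilleSarnakLiouvilleCutRank.PeriodicEngine

open Finset Function

/-- Iterating the self-similarity: `res^[n] (row of ιX^[n] x) = row of x`, where `res f = s · (f ∘ ιY)`.
[this file] -/
theorem iterate_res_row {X Y : Type*} (A : X → Y → ℤ) (ιX : X → X) (ιY : Y → Y) (s : ℤ) (hs : s * s = 1)
    (hF : ∀ x y, A (ιX x) (ιY y) = s * A x y) (n : ℕ) (x : X) :
    (fun f : Y → ℤ => fun y => s * f (ιY y))^[n] (A (ιX^[n] x)) = A x := by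
  induction n generalizing x with
  | zero => rfl
  | succ n ih =>
    rw [Function.iterate_succ_apply' ιX, Function.iterate_succ_apply]
    have h1 : (fun y => s * A (ιX (ιX^[n] x)) (ιY y)) = A (ιX^[n] x) := by
      funext y
      rw [hF, ← mul_assoc, hs, one_mul]
    rw [h1]
    exact ih x

/-- A self-map of a finite set into itself which is injective on it has a common period: some `L ≥ 1` with
`g^[L] f = f` for every `f` in the set. [folklore] -/
theorem exists_common_period {α : Type*} [DecidableEq α] (R : Finset α) (g : α → α)
    (hmaps : ∀ f ∈ R, g f ∈ R) (hinj : Set.InjOn g ↑R) :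
    ∃ L : ℕ, 1 ≤ L ∧ ∀ f ∈ R, g^[L] f = f := by
  classical
  -- iterates stay in `R` and are injective on `R`
  have hmaps_n : ∀ n, ∀ f ∈ R, g^[n] f ∈ R := by
    intro n
    induction n with
    | zero => intro f hf; exact hf
    | succ n ih => intro f hf; rw [Function.iterate_succ_apply]; exact ih _ (hmaps f hf)
  have hinj_n : ∀ n, Set.InjOn (g^[n]) ↑R := by
    intro n
    induction n with
    | zero => intro a _ b _ h; exact h
    | succ n ih =>
      intro a ha b hb h
      rw [Function.iterate_succ_apply, Function.iterate_succ_apply] at h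
      exact hinj ha hb (ih (hmaps a ha) (hmaps b hb) h)
  -- each element has a period in `[1, #R]`
  have hper : ∀ f ∈ R, ∃ d : ℕ, 1 ≤ d ∧ d ≤ R.card ∧ g^[d] f = f := by
    intro f hf
    have hc : R.card < (Finset.range (R.card + 1)).card := by simp
    obtain ⟨i, hi, j, hj, hij, heq⟩ := Finset.exists_ne_map_eq_of_card_lt_of_maps_to hc
      (f := fun n => g^[n] f) (fun n _ => Finset.mem_coe.mpr (hmaps_n n f hf))
    simp only [Finset.mem_range] at hi hj
    -- wlog `i < j`
    rcases lt_or_gt_of_ne hij with h | h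
    · refine ⟨j - i, by omega, by omega, ?_⟩
      have h2 : g^[i] (g^[j - i] f) = g^[i] f := by
        rw [← Function.iterate_add_apply, Nat.add_sub_cancel' h.le]; exact heq.symm
      exact hinj_n i (hmaps_n _ f hf) hf h2
    · refine ⟨i - j, by omega, by omega, ?_⟩
      have h2 : g^[j] (g^[i - j] f) = g^[j] f := by
        rw [← Function.iterate_add_apply, Nat.add_sub_cancel' h.le]; exact heq
      exact hinj_n j (hmaps_n _ f hf) hf h2
  refine ⟨R.card.factorial, Nat.succ_le_of_lt (Nat.factorial_pos _), fun f hf => ?_⟩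
  obtain ⟨d, hd1, hdR, hfix⟩ := hper f hf
  obtain ⟨k, hk⟩ := Nat.dvd_factorial hd1 hdR
  rw [hk, Function.iterate_mul]
  exact Function.iterate_fixed hfix k

/-- ★ **Periodic saturation engine.**  Let `A : X → Y → ℤ` have finitely many distinct rows and satisfy the
self-similarity `A (ιX x) (ιY y) = s · A x y` with `s · s = 1`.  Then for some `L ≥ 1` every row is invariant
under `ιX^[L]`: `A (ιX^[L] x) = A x` for all `x`.  (`res f := s · (f ∘ ιY)` maps the row of `ιX x` to the row of
`x`; so the finite row set is contained in its own image under `res`, hence `res` permutes it; take a common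
period `L` and note `res^[L] (row (ιX^[L] x)) = row x`.) [this file] -/
theorem exists_iterate_rows_eq {X Y : Type*} (A : X → Y → ℤ) (ιX : X → X) (ιY : Y → Y) (s : ℤ)
    (hs : s * s = 1) (hF : ∀ x y, A (ιX x) (ιY y) = s * A x y) (hfin : (Set.range A).Finite) :
    ∃ L : ℕ, 1 ≤ L ∧ ∀ x, A (ιX^[L] x) = A x := by
  classical
  set res : (Y → ℤ) → (Y → ℤ) := fun f => fun y => s * f (ιY y) with hres_def
  have hres : ∀ x, res (A (ιX x)) = A x := fun x =>
    iterate_res_row A ιX ιY s hs hF 1 x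
  -- the row set is contained in its image under `res`, hence `res` permutes it
  have hsub : hfin.toFinset ⊆ hfin.toFinset.image res := by
    intro f hf
    rw [Set.Finite.mem_toFinset] at hf
    obtain ⟨x, rfl⟩ := hf
    exact Finset.mem_image.mpr ⟨A (ιX x), by rw [Set.Finite.mem_toFinset]; exact ⟨ιX x, rfl⟩, hres x⟩
  have hEq : hfin.toFinset = hfin.toFinset.image res :=
    Finset.eq_of_subset_of_card_le hsub Finset.card_image_le
  have hmaps : ∀ f ∈ hfin.toFinset, res f ∈ hfin.toFinset := fun f hf => by
    rw [hEq]; exact Finset.mem_image_of_mem res hf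
  have hinj : Set.InjOn res ↑hfin.toFinset := by
    rw [← Finset.card_image_iff]; exact congrArg Finset.card hEq.symm
  obtain ⟨L, hL1, hL⟩ := exists_common_period hfin.toFinset res hmaps hinj
  refine ⟨L, hL1, fun x => ?_⟩
  have h1 : res^[L] (A (ιX^[L] x)) = A x := iterate_res_row A ιX ιY s hs hF L x
  have h2 : res^[L] (A (ιX^[L] x)) = A (ιX^[L] x) :=
    hL _ (by rw [Set.Finite.mem_toFinset]; exact ⟨_, rfl⟩)
  rw [← h1, h2]

/-- **Restriction injectivity.**  Under the same hypotheses, two rows that agree on all columns of the form `ιY y`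
agree everywhere. [this file] -/
theorem rows_eq_of_restrict_eq {X Y : Type*} (A : X → Y → ℤ) (ιX : X → X) (ιY : Y → Y) (s : ℤ)
    (hs : s * s = 1) (hF : ∀ x y, A (ιX x) (ιY y) = s * A x y) (hfin : (Set.range A).Finite)
    (x x' : X) (h : ∀ y, A x (ιY y) = A x' (ιY y)) : A x = A x' := by
  classical
  set res : (Y → ℤ) → (Y → ℤ) := fun f => fun y => s * f (ιY y) with hres_def
  have hres : ∀ x, res (A (ιX x)) = A x := fun x =>
    iterate_res_row A ιX ιY s hs hF 1 x
  have hsub : hfin.toFinset ⊆ hfin.toFinset.image res := by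
    intro f hf
    rw [Set.Finite.mem_toFinset] at hf
    obtain ⟨x, rfl⟩ := hf
    exact Finset.mem_image.mpr ⟨A (ιX x), by rw [Set.Finite.mem_toFinset]; exact ⟨ιX x, rfl⟩, hres x⟩
  have hEq : hfin.toFinset = hfin.toFinset.image res :=
    Finset.eq_of_subset_of_card_le hsub Finset.card_image_le
  have hinj : Set.InjOn res ↑hfin.toFinset := by
    rw [← Finset.card_image_iff]; exact congrArg Finset.card hEq.symm
  have hx : A x ∈ (↑hfin.toFinset : Set (Y → ℤ)) := by
    rw [Finset.mem_coe, Set.Finite.mem_toFinset]; exact ⟨x, rfl⟩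
  have hx' : A x' ∈ (↑hfin.toFinset : Set (Y → ℤ)) := by
    rw [Finset.mem_coe, Set.Finite.mem_toFinset]; exact ⟨x', rfl⟩
  refine hinj hx hx' ?_
  funext y
  show s * A x (ιY y) = s * A x' (ιY y)
  rw [h y]

/-- ★ **Invariance form for the zero row.**  With a distinguished index `x₀`, finitely many rows and the
self-similarity give `L ≥ 1` with `A x₀ = A (ιX^[L] x₀)`: for a periodic cut word `u^∞` this is
`λ(1 + κ) = λ(1 + R_{<pL} + κ)` for all column indices `κ` — the row of `0` equals the row of the number with all
`R`-bits of `L` full periods set.  (Immediate from `exists_iterate_rows_eq`.) [this file] -/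
theorem row_eq_iterate_row {X Y : Type*} (A : X → Y → ℤ) (ιX : X → X) (ιY : Y → Y) (s : ℤ)
    (hs : s * s = 1) (hF : ∀ x y, A (ιX x) (ιY y) = s * A x y) (hfin : (Set.range A).Finite) (x₀ : X) :
    ∃ L : ℕ, 1 ≤ L ∧ ∀ y, A x₀ y = A (ιX^[L] x₀) y := by
  obtain ⟨L, hL1, hL⟩ := exists_iterate_rows_eq A ιX ιY s hs hF hfin
  exact ⟨L, hL1, fun y => by rw [hL x₀]⟩

end Summit.ValiantsHypothesis.ValiantsHypothesis.Theorems.LiouvilleSarnakLiouvilleCutRank.PeriodicEngine
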